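import Summits.ValiantsHypothesis.ValiantsHypothesis.Theorems.BarrierLeverTransversalMinorLayoutsHeightFourCoded

/-!
# Route BarrierLever — conjecture TT (stmt-ValiantsHypothesis-19152): from a complex in `Fin 4` to its
# CODE SET (bridge lemmas for the rung «TT for every layout of height `h ≤ 4`»)

Helper file (`--supports stmt-ValiantsHypothesis-19152`; cell valiant-natproofs, rung V4, 𝒟-side of
door (c); seat val-np-p4 gen 10).  Closes NO item; imports only the Mathlib-level companion
`…TransversalMinorLayoutsHeightFourCoded` (tables `BIG`/`REQ`/`MEM`/`PERM`/`INV`/`ACT` and the coded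
`decide`s).  For an injective lower-set layout `u : Fin r → Finset (Fin 4)` with all four vertices
present (automatic when `r > 8`), the CODE SET is `t(u) = {x : Fin 11 | BIG x is a face}`; this file
proves that the coded data are the layout's data:

* `coded_lower` — `t(u)` is closed under `REQ`;
* `coded_card` — `r = |t(u)| + 5`;
* `coded_degree` — the literal class size `#{i : a ∈ u i}` (the DEGREE of `a`) is `#(t(u) ∩ MEM a) + 1`;
* `faces_map_of_coded` — if a tabulated coordinate permutation carries `t(u)` into the code set of a
  table `u₀` (containing `∅`, the vertices and `BIG` of that code set), every face of `u`, relabeled,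
  is a face of `u₀` (the hypothesis of `FiniteCheck.good_of_ppDerivable_relabel`);
* `faces_map_of_missing` / `degree_zero_of_missing` — a missing vertex `a`: after the swap `a ↔ 3`
  every face is a face of a full `3`-cube table, and `a` has degree `0`;
* `not_locked_of_degree_eq` — a common degree on the two sides contradicts the LOCKED hypothesis of
  the engine `FiniteCheck.tt_height_le_of_lockedCore`.

WHAT THIS IS NOT: bookkeeping; nothing on TT (19152) / items 19761, 19930 in general, on crux
stmt-ValiantsHypothesis-14610, or on `VP` versus `VNP`.
-/

-- layout Summits/ValiantsHypothesis/ValiantsHypothesis forces the duplicated namespace component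
set_option linter.dupNamespace false

open Matrix Finset

namespace Summit.ValiantsHypothesis.ValiantsHypothesis.Theorems.BarrierLever.FiniteCheck

/-! ## From a lower-set layout in `Fin 4` to its code set -/

/-- The code set of a complex is closed under `REQ` (coded lower-set-ness). -/
theorem coded_lower {r : ℕ} (u : Fin r → Finset (Fin 4)) (hl : IsLowerSet (Set.range u)) :
    ∀ x ∈ (Finset.univ.filter fun x : Fin 11 => ∃ i, u i = (![{0, 1}, {0, 2}, {1, 2}, {0, 1, 2}, {0, 3}, {1, 3}, {0, 1, 3}, {2, 3}, {0, 2, 3}, {1, 2, 3}, {0, 1, 2, 3}] : Fin 11 → Finset (Fin 4)) x), ∀ y ∈ (![(∅ : Finset (Fin 11)), (∅ : Finset (Fin 11)), (∅ : Finset (Fin 11)), ({0, 1, 2} : Finset (Fin 11)), (∅ : Finset (Fin 11)), (∅ : Finset (Fin 11)), ({0, 4, 5} : Finset (Fin 11)), (∅ : Finset (Fin 11)), ({1, 4, 7} : Finset (Fin 11)), ({2, 5, 7} : Finset (Fin 11)), ({0, 1, 2, 3, 4, 5, 6, 7, 8, 9} : Finset (Fin 11))] : Fin 11 → Finset (Fin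 11)) x, y ∈ (Finset.univ.filter fun x : Fin 11 => ∃ i, u i = (![{0, 1}, {0, 2}, {1, 2}, {0, 1, 2}, {0, 3}, {1, 3}, {0, 1, 3}, {2, 3}, {0, 2, 3}, {1, 2, 3}, {0, 1, 2, 3}] : Fin 11 → Finset (Fin 4)) x) := by
  intro x hx y hy
  simp only [Finset.mem_filter, Finset.mem_univ, true_and] at hx ⊢
  obtain ⟨i, hi⟩ := hx
  have hsub : (![{0, 1}, {0, 2}, {1, 2}, {0, 1, 2}, {0, 3}, {1, 3}, {0, 1, 3}, {2, 3}, {0, 2, 3}, {1, 2, 3}, {0, 1, 2, 3}] : Fin 11 → Finset (Fin 4)) y ⊆ u i := by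
    rw [hi]
    exact h4_big_sub_of_mem_req x y hy
  exact face_of_subset u hl hsub

/-- The big faces are `BIG` of the code set. -/
theorem image_filter_two_le {r : ℕ} (u : Fin r → Finset (Fin 4)) :
    (Finset.univ.filter fun i => 2 ≤ (u i).card).image u = ((Finset.univ.filter fun x : Fin 11 => ∃ i, u i = (![{0, 1}, {0, 2}, {1, 2}, {0, 1, 2}, {0, 3}, {1, 3}, {0, 1, 3}, {2, 3}, {0, 2, 3}, {1, 2, 3}, {0, 1, 2, 3}] : Fin 11 → Finset (Fin 4)) x)).image (![{0, 1}, {0, 2}, {1, 2}, {0, 1, 2}, {0, 3}, {1, 3}, {0, 1, 3}, {2, 3}, {0, 2, 3}, {1, 2, 3}, {0, 1, 2, 3}] : Fin 11 → Finset (Fin 4)) := by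
  ext A
  simp only [Finset.mem_image, Finset.mem_filter, Finset.mem_univ, true_and]
  constructor
  · rintro ⟨i, hi2, rfl⟩
    obtain ⟨x, hx⟩ := h4_exists_big_eq (u i) hi2
    exact ⟨x, ⟨i, hx.symm⟩, hx⟩
  · rintro ⟨x, ⟨i, hi⟩, rfl⟩
    exact ⟨i, by rw [hi]; exact h4_two_le_card_big x, hi⟩

/-- With all vertices present, the small faces are `∅` and the four vertices. -/
theorem image_filter_card_le_one {r : ℕ} (u : Fin r → Finset (Fin 4))
    (hl : IsLowerSet (Set.range u)) (h0 : 0 < r) (hs : ∀ a : Fin 4, ∃ i, u i = {a}) :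
    (Finset.univ.filter fun i => (u i).card ≤ 1).image u =
      ({∅, {0}, {1}, {2}, {3}} : Finset (Finset (Fin 4))) := by
  ext A
  simp only [Finset.mem_image, Finset.mem_filter, Finset.mem_univ, true_and, Finset.mem_insert,
    Finset.mem_singleton]
  constructor
  · rintro ⟨i, hi1, rfl⟩
    rcases h4_card_le_one (u i) hi1 with h | ⟨b, hb⟩
    · exact Or.inl h
    · rw [hb]
      right
      fin_cases b
      · exact Or.inl rfl
      · exact Or.inr (Or.inl rfl)
      · exact Or.inr (Or.inr (Or.inl rfl))
      · exact Or.inr (Or.inr (Or.inr rfl))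
  · intro hA
    have hex : A.card ≤ 1 ∧ ∃ i, u i = A := by
      rcases hA with rfl | rfl | rfl | rfl | rfl
      · exact ⟨by simp, exists_eq_empty_of_pos u hl h0⟩
      · exact ⟨by simp, hs 0⟩
      · exact ⟨by simp, hs 1⟩
      · exact ⟨by simp, hs 2⟩
      · exact ⟨by simp, hs 3⟩
    obtain ⟨hc, i, hi⟩ := hex
    exact ⟨i, by rw [hi]; exact hc, hi⟩

/-- **Coded cardinality**: `r = 5 + |t|` when all vertices are present. -/
theorem coded_card {r : ℕ} (u : Fin r → Finset (Fin 4)) (hu : Function.Injective u)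
    (hl : IsLowerSet (Set.range u)) (h0 : 0 < r) (hs : ∀ a : Fin 4, ∃ i, u i = {a}) :
    ((Finset.univ.filter fun x : Fin 11 => ∃ i, u i = (![{0, 1}, {0, 2}, {1, 2}, {0, 1, 2}, {0, 3}, {1, 3}, {0, 1, 3}, {2, 3}, {0, 2, 3}, {1, 2, 3}, {0, 1, 2, 3}] : Fin 11 → Finset (Fin 4)) x)).card + 5 = r := by
  have hsplit := Finset.card_filter_add_card_filter_not
    (s := (Finset.univ : Finset (Fin r))) (fun i => (u i).card ≤ 1)
  have hA : (Finset.univ.filter fun i => (u i).card ≤ 1).card = 5 := by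
    have e := congrArg Finset.card (image_filter_card_le_one u hl h0 hs)
    rw [Finset.card_image_of_injective _ hu] at e
    rw [e]
    decide
  have hB : (Finset.univ.filter fun i => ¬ (u i).card ≤ 1).card = ((Finset.univ.filter fun x : Fin 11 => ∃ i, u i = (![{0, 1}, {0, 2}, {1, 2}, {0, 1, 2}, {0, 3}, {1, 3}, {0, 1, 3}, {2, 3}, {0, 2, 3}, {1, 2, 3}, {0, 1, 2, 3}] : Fin 11 → Finset (Fin 4)) x)).card := by
    have e1 : (Finset.univ.filter fun i => ¬ (u i).card ≤ 1) =
        (Finset.univ.filter fun i => 2 ≤ (u i).card) := by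
      apply Finset.filter_congr
      intro i _
      omega
    have e2 := congrArg Finset.card (image_filter_two_le u)
    rw [Finset.card_image_of_injective _ hu, Finset.card_image_of_injective _ h4_big_injective] at e2
    rw [e1, e2]
  rw [hA, hB, Finset.card_univ, Fintype.card_fin] at hsplit
  omega

/-- **Coded degrees**: the number of faces containing `a` is one (the vertex `{a}`) plus the number
of big faces containing `a`. -/
theorem coded_degree {r : ℕ} (u : Fin r → Finset (Fin 4)) (hu : Function.Injective u)
    (hs : ∀ a : Fin 4, ∃ i, u i = {a}) (a : Fin 4) :
    (Finset.univ.filter fun i => a ∈ u i).card = (((Finset.univ.filter fun x : Fin 11 => ∃ i, u i = (![{0, 1}, {0, 2}, {1, 2}, {0, 1, 2}, {0, 3}, {1, 3}, {0, 1, 3}, {2, 3}, {0, 2, 3}, {1, 2, 3}, {0, 1, 2, 3}] : Fin 11 → Finset (Fin 4)) x)).filter fun x => x ∈ (![({0, 1, 3, 4, 6, 8, 10} : Finset (Fin 11)), ({0, 2, 3, 5, 6, 9, 10} : Finset (Fin 11)), ({1, 2, 3, 7, 8, 9, 10} : Finset (Fin 11)), ({4, 5, 6, 7, 8, 9, 10}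 : Finset (Fin 11))] : Fin 4 → Finset (Fin 11)) a).card + 1 := by
  have hsplit := Finset.card_filter_add_card_filter_not
    (s := Finset.univ.filter fun i => a ∈ u i) (fun i => (u i).card ≤ 1)
  have h1 : ((Finset.univ.filter fun i => a ∈ u i).filter fun i => (u i).card ≤ 1).card = 1 := by
    rw [Finset.card_eq_one]
    obtain ⟨i₀, hi₀⟩ := hs a
    refine ⟨i₀, ?_⟩
    ext i
    simp only [Finset.mem_filter, Finset.mem_univ, true_and, Finset.mem_singleton]
    constructor
    · rintro ⟨hai, hc⟩
      apply hu
      rw [hi₀]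
      exact h4_eq_singleton_of_mem (u i) a hc hai
    · rintro rfl
      rw [hi₀]
      simp
  have h2 : ((Finset.univ.filter fun i => a ∈ u i).filter fun i => ¬ (u i).card ≤ 1).card =
      (((Finset.univ.filter fun x : Fin 11 => ∃ i, u i = (![{0, 1}, {0, 2}, {1, 2}, {0, 1, 2}, {0, 3}, {1, 3}, {0, 1, 3}, {2, 3}, {0, 2, 3}, {1, 2, 3}, {0, 1, 2, 3}] : Fin 11 → Finset (Fin 4)) x)).filter fun x => x ∈ (![({0, 1, 3, 4, 6, 8, 10} : Finset (Fin 11)), ({0, 2, 3, 5, 6, 9, 10} : Finset (Fin 11)), ({1, 2, 3, 7, 8, 9, 10} : Finset (Fin 11)), ({4, 5, 6, 7, 8, 9, 10} : Finset (Fin 11))] : Fin 4 → Finset (Fin 11)) a).card := by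
    have e : ((Finset.univ.filter fun i => a ∈ u i).filter fun i => ¬ (u i).card ≤ 1).image u =
        ((((Finset.univ.filter fun x : Fin 11 => ∃ i, u i = (![{0, 1}, {0, 2}, {1, 2}, {0, 1, 2}, {0, 3}, {1, 3}, {0, 1, 3}, {2, 3}, {0, 2, 3}, {1, 2, 3}, {0, 1, 2, 3}] : Fin 11 → Finset (Fin 4)) x)).filter fun x => x ∈ (![({0, 1, 3, 4, 6, 8, 10} : Finset (Fin 11)), ({0, 2, 3, 5, 6, 9, 10} : Finset (Fin 11)), ({1, 2, 3, 7, 8, 9, 10} : Finset (Fin 11)), ({4, 5, 6, 7, 8, 9, 10} : Finset (Fin 11))] : Fin 4 → Finset (Fin 11)) a)).image (![{0, 1}, {0, 2}, {1, 2}, {0, 1, 2}, {0, 3}, {1, 3}, {0, 1, 3}, {2, 3}, {0, 2, 3}, {1, 2, 3}, {0, 1, 2, 3}] : Fin 11 → Finset (Fin 4)) := by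
      ext A
      simp only [Finset.mem_image, Finset.mem_filter, Finset.mem_univ, true_and]
      constructor
      · rintro ⟨i, ⟨hai, hc⟩, rfl⟩
        obtain ⟨x, hx⟩ := h4_exists_big_eq (u i) (by omega)
        refine ⟨x, ⟨⟨i, hx.symm⟩, (h4_mem_memTab_iff a x).mpr ?_⟩, hx⟩
        rw [hx]
        exact hai
      · rintro ⟨x, ⟨⟨i, hi⟩, hxm⟩, rfl⟩
        refine ⟨i, ⟨?_, ?_⟩, hi⟩
        · rw [hi]
          exact (h4_mem_memTab_iff a x).mp hxm
        · rw [hi]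
          have h2x := h4_two_le_card_big x
          omega
    have e2 := congrArg Finset.card e
    rw [Finset.card_image_of_injective _ hu, Finset.card_image_of_injective _ h4_big_injective] at e2
    exact e2
  omega

/-- Literal classes in the locked hypothesis are degrees. -/
theorem card_filter_iff_true {r h : ℕ} (u : Fin r → Finset (Fin h)) (a : Fin h) :
    (Finset.univ.filter fun i => (a ∈ u i ↔ true = true)).card =
      (Finset.univ.filter fun i => a ∈ u i).card := by
  congr 1
  apply Finset.filter_congr
  intro i _
  simp

/-- **Transport data from the code set.**  If a tabulated coordinate permutation `π` with code action
`act` carries the code set of `u` into the code set `T₀` of a table `u₀` containing `∅`, all vertices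
and `BIG` of `T₀`, then every face of `u`, relabeled by `π`, is a face of `u₀`. -/
theorem faces_map_of_coded {r n₀ : ℕ} (u : Fin r → Finset (Fin 4))
    (hs : ∀ a : Fin 4, ∃ i, u i = {a}) (π : Equiv.Perm (Fin 4)) (act : Fin 11 → Fin 11)
    (hact : ∀ (x : Fin 11) (b : Fin 4), (b ∈ (![{0, 1}, {0, 2}, {1, 2}, {0, 1, 2}, {0, 3}, {1, 3}, {0, 1, 3}, {2, 3}, {0, 2, 3}, {1, 2, 3}, {0, 1, 2, 3}] : Fin 11 → Finset (Fin 4)) (act x) ↔ π.symm b ∈ (![{0, 1}, {0, 2}, {1, 2}, {0, 1, 2}, {0, 3}, {1, 3}, {0, 1, 3}, {2, 3}, {0, 2, 3}, {1, 2, 3}, {0, 1, 2, 3}] : Fin 11 → Finset (Fin 4)) x))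
    (u₀ : Fin n₀ → Finset (Fin 4)) (T₀ : Finset (Fin 11)) (he : ∃ i', u₀ i' = ∅)
    (hv : ∀ b : Fin 4, ∃ i', u₀ i' = {b}) (hb : ∀ y ∈ T₀, ∃ i', u₀ i' = (![{0, 1}, {0, 2}, {1, 2}, {0, 1, 2}, {0, 3}, {1, 3}, {0, 1, 3}, {2, 3}, {0, 2, 3}, {1, 2, 3}, {0, 1, 2, 3}] : Fin 11 → Finset (Fin 4)) y)
    (hT : ∀ x ∈ (Finset.univ.filter fun x : Fin 11 => ∃ i, u i = (![{0, 1}, {0, 2}, {1, 2}, {0, 1, 2}, {0, 3}, {1, 3}, {0, 1, 3}, {2, 3}, {0, 2, 3}, {1, 2, 3}, {0, 1, 2, 3}] : Fin 11 → Finset (Fin 4)) x), act x ∈ T₀) :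
    ∀ i, ∃ i', (u i).map π.toEmbedding = u₀ i' := by
  have _ := hs
  intro i
  by_cases hc : (u i).card ≤ 1
  · rcases h4_card_le_one (u i) hc with h | ⟨b, hb'⟩
    · obtain ⟨i', hi'⟩ := he
      exact ⟨i', by rw [h, Finset.map_empty, hi']⟩
    · obtain ⟨i', hi'⟩ := hv (π b)
      refine ⟨i', ?_⟩
      rw [hb', Finset.map_singleton, hi']
      rfl
  · obtain ⟨x, hx⟩ := h4_exists_big_eq (u i) (by omega)
    have hxT : x ∈ (Finset.univ.filter fun x : Fin 11 => ∃ i, u i = (![{0, 1}, {0, 2}, {1, 2}, {0, 1, 2}, {0, 3}, {1, 3}, {0, 1, 3}, {2, 3}, {0, 2, 3}, {1, 2, 3}, {0, 1, 2, 3}] : Fin 11 → Finset (Fin 4)) x) := by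
      simp only [Finset.mem_filter, Finset.mem_univ, true_and]
      exact ⟨i, hx.symm⟩
    obtain ⟨i', hi'⟩ := hb (act x) (hT x hxT)
    have hmap : (u i).map π.toEmbedding = (![{0, 1}, {0, 2}, {1, 2}, {0, 1, 2}, {0, 3}, {1, 3}, {0, 1, 3}, {2, 3}, {0, 2, 3}, {1, 2, 3}, {0, 1, 2, 3}] : Fin 11 → Finset (Fin 4)) (act x) := by
      ext b
      rw [← hx, Finset.mem_map_equiv]
      exact (hact x b).symm
    exact ⟨i', by rw [hmap, hi']⟩

/-- **Transport data for a missing vertex.**  If the vertex `a` is missing, every face avoids `a`,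
so after the swap `a ↔ 3` every face is a face of a full `3`-cube table on `{0, 1, 2}`. -/
theorem faces_map_of_missing {r : ℕ} (u : Fin r → Finset (Fin 4)) (hl : IsLowerSet (Set.range u))
    (a : Fin 4) (hne : ∀ i, u i ≠ {a}) (u₀ : Fin 8 → Finset (Fin 4))
    (h₀ : ∀ B : Finset (Fin 4), (3 : Fin 4) ∉ B → ∃ i : Fin 8, u₀ i = B) :
    ∀ i, ∃ i', (u i).map (Equiv.swap a 3).toEmbedding = u₀ i' := by
  intro i
  have hna := not_mem_of_singleton_missing u hl a hne i
  have h3 : (3 : Fin 4) ∉ (u i).map (Equiv.swap a 3).toEmbedding := by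
    rw [Finset.mem_map_equiv, Equiv.symm_swap, Equiv.swap_apply_right]
    exact hna
  obtain ⟨i', hi'⟩ := h₀ _ h3
  exact ⟨i', hi'.symm⟩

/-- A missing vertex has degree `0`. -/
theorem degree_zero_of_missing {r : ℕ} (u : Fin r → Finset (Fin 4)) (hl : IsLowerSet (Set.range u))
    (a : Fin 4) (hne : ∀ i, u i ≠ {a}) : (Finset.univ.filter fun i => a ∈ u i).card = 0 := by
  rw [Finset.card_eq_zero]
  exact Finset.filter_false_of_mem fun i _ => not_mem_of_singleton_missing u hl a hne i

/-- A common degree unlocks a pair. -/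
theorem not_locked_of_degree_eq {r : ℕ} (u w : Fin r → Finset (Fin 4)) (a c : Fin 4)
    (hdeg : (Finset.univ.filter fun i => a ∈ u i).card = (Finset.univ.filter fun i => c ∈ w i).card)
    (hlk : (∀ (a c : Fin 4) (β γ : Bool),
      (Finset.univ.filter fun i => (a ∈ u i ↔ β = true)).card ≠
        (Finset.univ.filter fun j => (c ∈ w j ↔ γ = true)).card)) : False := by
  apply hlk a c true true
  rw [card_filter_iff_true, card_filter_iff_true]
  exact hdeg

end Summit.ValiantsHypothesis.ValiantsHypothesis.Theorems.BarrierLever.FiniteCheck
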